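import Summits.KontsevichZagierPeriods.KontsevichZagierPeriods.Theorems.FurushoPentagonSectorToKernelAffineOpenBand
import Literature.NumberTheory.Transcendental.KZSemiCanonicalReductionProofs
import Literature.NumberTheory.Transcendental.KZProductIdeal
import Literature.NumberTheory.Transcendental.NashCubes
import Summits.KontsevichZagierPeriods.KontsevichZagierPeriods.Theorems.HurwitzMicroSectorsHurwitzSectorComplementStubArcDissectionAux

/-!
# `SectorToKernel` (stmt-KontsevichZagierPeriods-10813), line `effective-cube-surjection`:
# the corner blow-up of the open cube is a chain of moves (all dimensions)

Infrastructure towards the remaining theorem-grade stub G = `stub_openCubeNashResolution` (= the second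
registered stub of item stmt-KontsevichZagierPeriods-17978: rectilinearisation of the boundary singularities of an
open-cube Nash integrand).  The blow-up of the open cube `(0,1)ᵐ⁺¹` along the codimension-two corner
`{xᵢ = x_last = 0}` is realised by Kontsevich–Zagier moves: cut the cube along the null hyperplane
`{x_last = xᵢ}` (rule (1a)) into the wedges `{x_last < xᵢ}` and `{xᵢ < x_last}`; the first wedge is the open
band over `(0,1)ᵐ` with walls `0 < s < yᵢ`, straightened onto the cube by the affine move of stub B
(`stub_affineOpenBand`, substitution `x_last = xᵢ t`, Jacobian `xᵢ`); the second wedge is the first one with the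
coordinates `i` and `last` exchanged (`KZ.of_sub_of_reindex_mem_relations`).  Result: `[v] ≡ [v₁] + [v₂]` with
`v₁ (z) = v (…, zᵢ, …, zᵢ z_last) · zᵢ` and `v₂ (z) = v (…, zᵢ z_last, …, z_last) · z_last` on the open cube — the
two charts of the blow-up, as used for `ζ(2)` in `…ZetaTwoBoxResolved`.
[Kontsevich–Zagier 2001, §1.2 rules (1), (2)]
-/

noncomputable section

namespace Summit.KontsevichZagierPeriods.FurushoPentagon.SectorToKernel

open Set MeasureTheory Filter Topology
open Literature.ModelTheory.ExponentialFields
open Literature.NumberTheory.Transcendental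
open Literature.NumberTheory.Transcendental.KZ

/-! ## The wedge below the diagonal -/

/-- The wedge `{x ∈ (0,1)ᵐ⁺¹ | x_last < xᵢ}` is the open band over `(0,1)ᵐ` with walls `0` and `yᵢ`. [folklore] -/
theorem wedge_eq_band {m : ℕ} (i : Fin m) :
    {x : Fin (m + 1) → ℝ | (∀ k, 0 < x k ∧ x k < 1) ∧ x (Fin.last m) < x (Fin.castSucc i)} =
      {z : Fin (m + 1) → ℝ | (Fin.init z : Fin m → ℝ) ∈ {y : Fin m → ℝ | ∀ k, 0 < y k ∧ y k < 1} ∧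
        (fun _ : Fin m → ℝ => (0:ℝ)) (Fin.init z) < z (Fin.last m) ∧
        z (Fin.last m) < (fun _ : Fin m → ℝ => (0:ℝ)) (Fin.init z) + (fun y : Fin m → ℝ => y i) (Fin.init z)} := by
  ext x
  simp only [mem_setOf_eq, zero_add]
  constructor
  · rintro ⟨hcube, hlt⟩
    exact ⟨fun k => hcube (Fin.castSucc k), (hcube (Fin.last m)).1, hlt⟩
  · rintro ⟨hinit, h0, hlt⟩
    refine ⟨fun k => ?_, hlt⟩
    refine Fin.lastCases ?_ (fun j => ?_) k
    · exact ⟨h0, hlt.trans (hinit i).2⟩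
    · exact hinit j

/-- The wedge below the diagonal is `ℚ`-semialgebraic. [folklore] -/
theorem isSemialgebraic_wedge {m : ℕ} (i : Fin m) :
    IsSemialgebraic ℚ {x : Fin (m + 1) → ℝ | (∀ k, 0 < x k ∧ x k < 1) ∧ x (Fin.last m) < x (Fin.castSucc i)} := by
  have h1 : IsSemialgebraic ℚ {x : Fin (m + 1) → ℝ | ∀ k, 0 < x k ∧ x k < 1} :=
    Literature.NumberTheory.Transcendental.isSemialgebraic_openUnitCube
  have h2 : IsSemialgebraic ℚ {x : Fin (m + 1) → ℝ | x (Fin.last m) < x (Fin.castSucc i)} := by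
    have h := isSemialgebraic_setOf_eval_lt (k := ℚ) (R := ℝ)
      (MvPolynomial.X (Fin.last m) : MvPolynomial (Fin (m + 1)) ℚ) (MvPolynomial.X (Fin.castSucc i))
    simpa only [MvPolynomial.aeval_X] using h
  exact h1.inter h2

/-- **First chart.**  For a representation `v` on the open cube, the piece over the wedge `{x_last < xᵢ}`
is congruent modulo relations to the representation on the open cube with integrand
`z ↦ v (init z, zᵢ z_last) · zᵢ` (the affine move of stub B with `α = 0`, `β = yᵢ`).
[cite: KontsevichZagier2001, §1.2 rule (2)] -/
theorem exists_wedge_chart {m : ℕ} (i : Fin m) (w : IntegralRep (m + 1))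
    (hw : w.domain = {x : Fin (m + 1) → ℝ | (∀ k, 0 < x k ∧ x k < 1) ∧ x (Fin.last m) < x (Fin.castSucc i)}) :
    ∃ v₁ : IntegralRep (m + 1), v₁.domain = {x : Fin (m + 1) → ℝ | ∀ k, 0 < x k ∧ x k < 1} ∧
      (v₁.integrand = fun z => w.integrand (Fin.snoc (Fin.init z) (z (Fin.castSucc i) * z (Fin.last m))) *
        z (Fin.castSucc i)) ∧
      of v₁ - of w ∈ relations := by
  have hGo : IsOpen {y : Fin m → ℝ | ∀ k, 0 < y k ∧ y k < 1} := Literature.NumberTheory.Transcendental.isOpen_openUnitCube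
  have hGs : IsSemialgebraic ℚ {y : Fin m → ℝ | ∀ k, 0 < y k ∧ y k < 1} :=
    Literature.NumberTheory.Transcendental.isSemialgebraic_openUnitCube
  have hαs : IsSemialgebraicFunOn ℚ {y : Fin m → ℝ | ∀ k, 0 < y k ∧ y k < 1} (fun _ => (0:ℝ)) := by
    simpa using isSemialgebraicFunOn_ratCast hGs 0
  have hβs : IsSemialgebraicFunOn ℚ {y : Fin m → ℝ | ∀ k, 0 < y k ∧ y k < 1} (fun y => y i) :=
    isSemialgebraicFunOn_apply hGs i
  have hαd : DifferentiableOn ℝ (fun _ : Fin m → ℝ => (0:ℝ)) {y : Fin m → ℝ | ∀ k, 0 < y k ∧ y k < 1} :=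
    differentiableOn_const _
  have hβd : DifferentiableOn ℝ (fun y : Fin m → ℝ => y i) {y : Fin m → ℝ | ∀ k, 0 < y k ∧ y k < 1} :=
    fun y _ => (differentiableAt_apply (𝕜 := ℝ) i y).differentiableWithinAt
  have hβpos : ∀ y ∈ {y : Fin m → ℝ | ∀ k, 0 < y k ∧ y k < 1}, 0 < (fun y : Fin m → ℝ => y i) y :=
    fun y hy => (hy i).1
  obtain ⟨v₁, hv₁d, hv₁i, hv₁⟩ := stub_affineOpenBand hGo hGs hαs hβs hαd hβd hβpos w (by rw [hw, wedge_eq_band])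
  refine ⟨v₁, ?_, ?_, hv₁⟩
  · rw [hv₁d]
    ext z
    simp only [mem_setOf_eq]
    constructor
    · rintro ⟨hinit, h0, h1⟩ k
      refine Fin.lastCases ?_ (fun j => ?_) k
      · exact ⟨h0, h1⟩
      · exact hinit j
    · intro h
      exact ⟨fun j => h (Fin.castSucc j), (h (Fin.last m)).1, (h (Fin.last m)).2⟩
  · rw [hv₁i]
    funext z
    simp only [zero_add]
    rfl

/-! ## The blow-up -/

/-- **The corner blow-up of the open cube is a chain of moves.**  For every representation `v` on the open
cube `(0,1)ᵐ⁺¹` and every coordinate `i < m` there are representations `v₁`, `v₂` on the open cube with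
`v₁ (z) = v (init z, zᵢ z_last) · zᵢ` and, on the cube, `v₂ (z) = v (z with zᵢ ↦ zᵢ z_last) · z_last`, such that
`[v] − [v₁] − [v₂] ∈ relations` (cut along the null hyperplane `x_last = xᵢ`, rule (1a); the two wedges are the
two charts of the blow-up of the corner `{xᵢ = x_last = 0}`, rule (2) via stub B, the second after exchanging
the coordinates `i` and `last`). [cite: KontsevichZagier2001, §1.2 rules (1),(2)] -/
theorem cornerBlowup_last {m : ℕ} (i : Fin m) (v : IntegralRep (m + 1))
    (hv : v.domain = {x : Fin (m + 1) → ℝ | ∀ k, 0 < x k ∧ x k < 1}) :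
    ∃ v₁ v₂ : IntegralRep (m + 1),
      v₁.domain = {x : Fin (m + 1) → ℝ | ∀ k, 0 < x k ∧ x k < 1} ∧
      v₂.domain = {x : Fin (m + 1) → ℝ | ∀ k, 0 < x k ∧ x k < 1} ∧
      (v₁.integrand = fun z => v.integrand (Fin.snoc (Fin.init z) (z (Fin.castSucc i) * z (Fin.last m))) *
        z (Fin.castSucc i)) ∧
      (v₂.integrand = fun z => v.integrand (Function.update z (Fin.castSucc i) (z (Fin.castSucc i) * z (Fin.last m))) *
        z (Fin.last m)) ∧
      of v - of v₁ - of v₂ ∈ relations := by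
  classical
  have hil : Fin.castSucc i ≠ Fin.last m := (Fin.castSucc_lt_last i).ne
  set C : Set (Fin (m + 1) → ℝ) := {x : Fin (m + 1) → ℝ | ∀ k, 0 < x k ∧ x k < 1} with hC
  set W₁ : Set (Fin (m + 1) → ℝ) := {x | (∀ k, 0 < x k ∧ x k < 1) ∧ x (Fin.last m) < x (Fin.castSucc i)} with hW₁
  set W₂ : Set (Fin (m + 1) → ℝ) := {x | (∀ k, 0 < x k ∧ x k < 1) ∧ x (Fin.castSucc i) < x (Fin.last m)} with hW₂
  have hW₁s : IsSemialgebraic ℚ W₁ := isSemialgebraic_wedge i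
  -- the coordinate exchange `i ↔ last`
  set e : Fin (m + 1) ≃ Fin (m + 1) := Equiv.swap (Fin.castSucc i) (Fin.last m) with he
  have he1 : e (Fin.castSucc i) = Fin.last m := by rw [he, Equiv.swap_apply_left]
  have he2 : e (Fin.last m) = Fin.castSucc i := by rw [he, Equiv.swap_apply_right]
  have he3 : ∀ k, k ≠ Fin.castSucc i → k ≠ Fin.last m → e k = k := fun k h1 h2 => by
    rw [he, Equiv.swap_apply_of_ne_of_ne h1 h2]
  have hcube_swap : ∀ x : Fin (m + 1) → ℝ, (∀ k, 0 < x k ∧ x k < 1) → ∀ k, 0 < x (e k) ∧ x (e k) < 1 :=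
    fun x hx k => hx (e k)
  have hW₂s : IsSemialgebraic ℚ W₂ := by
    have h := hW₁s.preimage_comp e
    convert h using 1
    ext x
    simp only [hW₁, hW₂, mem_setOf_eq, mem_preimage, Function.comp_apply, he1, he2]
    constructor
    · rintro ⟨hx, hlt⟩; exact ⟨fun k => hx (e k), hlt⟩
    · rintro ⟨hx, hlt⟩
      refine ⟨fun k => ?_, hlt⟩
      simpa [he, Equiv.swap_apply_self] using hx (e k)
  have hW₁C : W₁ ⊆ v.domain := by rw [hv]; exact fun x hx => hx.1
  have hW₂C : W₂ ⊆ v.domain := by rw [hv]; exact fun x hx => hx.1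
  set R₁ : IntegralRep (m + 1) := v.restrict W₁ hW₁s hW₁C with hR₁
  set R₂ : IntegralRep (m + 1) := v.restrict W₂ hW₂s hW₂C with hR₂
  -- Step 1: cut along the diagonal (rule (1a))
  have hcut : of v - of R₁ - of R₂ ∈ relations := by
    have h := of_sub_sum_of_mem_relations (Finset.univ : Finset (Fin 2)) v ![R₁, R₂] (fun j _ => ?_)
      (fun j _ x _ => ?_) ?_ ?_
    · simpa [Fin.sum_univ_two, sub_sub] using h
    · fin_cases j
      · simp [hR₁, Set.sdiff_eq_empty.2 hW₁C]
      · simp [hR₂, Set.sdiff_eq_empty.2 hW₂C]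
    · fin_cases j <;> rfl
    · refine measure_mono_null (fun x hx => ?_) (Summit.KontsevichZagierPeriods.Theorems.HurwitzMicroSectorsHurwitzSectorComplement.ArcDissection.volume_setOf_last_eq_castSucc i)
      have hxC : ∀ k, 0 < x k ∧ x k < 1 := by have h := hx.1; rw [hv] at h; exact h
      have h1 : x ∉ W₁ := fun h => hx.2 (mem_iUnion₂.2 ⟨0, Finset.mem_univ _, by simpa [hR₁] using h⟩)
      have h2 : x ∉ W₂ := fun h => hx.2 (mem_iUnion₂.2 ⟨1, Finset.mem_univ _, by simpa [hR₂] using h⟩)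
      simp only [hW₁, hW₂, mem_setOf_eq, not_and, not_lt] at h1 h2
      exact le_antisymm (h2 hxC) (h1 hxC)
    · intro j _ j' _ hne
      have hdisj : W₁ ∩ W₂ = ∅ := eq_empty_of_forall_notMem fun x hx => lt_asymm hx.1.2 hx.2.2
      fin_cases j <;> fin_cases j'
      · exact absurd rfl hne
      · show volume (R₁.domain ∩ R₂.domain) = 0
        rw [hR₁, hR₂, IntegralRep.domain_restrict, IntegralRep.domain_restrict, hdisj, measure_empty]
      · show volume (R₂.domain ∩ R₁.domain) = 0
        rw [hR₁, hR₂, IntegralRep.domain_restrict, IntegralRep.domain_restrict, inter_comm, hdisj, measure_empty]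
      · exact absurd rfl hne
  -- Step 2: first chart
  obtain ⟨v₁, hv₁d, hv₁i, hv₁⟩ := exists_wedge_chart i R₁ (by rw [hR₁, IntegralRep.domain_restrict])
  -- Step 3: second chart, after exchanging `i` and `last`
  set R₂' : IntegralRep (m + 1) := R₂.reindex e with hR₂'
  have hR₂'d : R₂'.domain = W₁ := by
    rw [hR₂', IntegralRep.reindex_domain, hR₂, IntegralRep.domain_restrict]
    ext x
    simp only [hW₁, hW₂, mem_setOf_eq, he1, he2]
    constructor
    · rintro ⟨hx, hlt⟩
      refine ⟨fun k => ?_, hlt⟩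
      simpa [he, Equiv.swap_apply_self] using hx (e k)
    · rintro ⟨hx, hlt⟩; exact ⟨fun k => hx (e k), hlt⟩
  obtain ⟨u₂, hu₂d, hu₂i, hu₂⟩ := exists_wedge_chart i R₂' hR₂'d
  set v₂ : IntegralRep (m + 1) := u₂.reindex e with hv₂
  have hv₂d : v₂.domain = C := by
    rw [hv₂, IntegralRep.reindex_domain, hu₂d]
    ext x
    simp only [hC, mem_setOf_eq]
    constructor
    · intro hx k; simpa [he, Equiv.swap_apply_self] using hx (e k)
    · intro hx k; exact hx (e k)
  have hv₂i : v₂.integrand = fun z => v.integrand (Function.update z (Fin.castSucc i)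
      (z (Fin.castSucc i) * z (Fin.last m))) * z (Fin.last m) := by
    rw [hv₂, IntegralRep.reindex_integrand, hu₂i]
    funext z
    simp only [hR₂', IntegralRep.reindex_integrand, hR₂, IntegralRep.integrand_restrict, he1, he2]
    congr 1
    congr 1
    funext k
    by_cases hk1 : k = Fin.castSucc i
    · subst hk1
      rw [he1, Fin.snoc_last, Function.update_self]
      exact mul_comm _ _
    · by_cases hk2 : k = Fin.last m
      · subst hk2
        rw [he2, Fin.snoc_castSucc, Function.update_of_ne hil.symm]
        simp [Fin.init, he1]
      · rw [he3 k hk1 hk2, Function.update_of_ne hk1]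
        have hk : k = Fin.castSucc (k.castPred hk2) := (Fin.castSucc_castPred k hk2).symm
        conv_lhs => rw [hk, Fin.snoc_castSucc]
        simp only [Fin.init]
        rw [← hk, he3 k hk1 hk2]
  refine ⟨v₁, v₂, hv₁d, hv₂d, hv₁i, hv₂i, ?_⟩
  have e1 : of R₂ - of R₂' ∈ relations := of_sub_of_reindex_mem_relations R₂ e
  have e2 : of u₂ - of v₂ ∈ relations := of_sub_of_reindex_mem_relations u₂ e
  have : of v - of v₁ - of v₂ = (of v - of R₁ - of R₂) - (of v₁ - of R₁) + (of R₂ - of R₂') -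
      (of u₂ - of R₂') + (of u₂ - of v₂) := by abel
  rw [this]
  exact relations.add_mem (relations.sub_mem (relations.add_mem (relations.sub_mem hcut hv₁) e1) hu₂) e2

/-- **The corner blow-up of the open cube is a chain of moves** (registered form).  See `cornerBlowup_last`.
[cite: KontsevichZagier2001, §1.2 rules (1),(2)] -/
theorem cornerBlowup : ∀ (m : ℕ) (i : Fin m) (v : IntegralRep (m + 1)),
    v.domain = {x : Fin (m + 1) → ℝ | ∀ k, 0 < x k ∧ x k < 1} →
    ∃ v₁ v₂ : IntegralRep (m + 1),
      v₁.domain = {x : Fin (m + 1) → ℝ | ∀ k, 0 < x k ∧ x k < 1} ∧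
      v₂.domain = {x : Fin (m + 1) → ℝ | ∀ k, 0 < x k ∧ x k < 1} ∧
      (v₁.integrand = fun z => v.integrand (Fin.snoc (Fin.init z) (z (Fin.castSucc i) * z (Fin.last m))) *
        z (Fin.castSucc i)) ∧
      (v₂.integrand = fun z => v.integrand (Function.update z (Fin.castSucc i) (z (Fin.castSucc i) * z (Fin.last m))) *
        z (Fin.last m)) ∧
      of v - of v₁ - of v₂ ∈ relations :=
  fun _ i v hv => cornerBlowup_last i v hv

end Summit.KontsevichZagierPeriods.FurushoPentagon.SectorToKernel
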